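import Mathlib

/-!
# Reflection defects of same-colour structures (crux `HyperoctahedralThreshold`, refutation line, lead c3)

Three involutions `μ b` ("colours") on `Fin n` act on the right by `x · w := w.foldl (fun v b => μ b v) x`.
A **same-colour structure** of colour `c` and length `m` is a pair `(a, g)`, `g` a reduced word of length `m`
with end letters `≠ c`, such that `μ c (a · g) = (μ c a) · g`; its **rungs** are
`r_s = (p_s, q_s) := (a · g.take s, (μ c a) · g.take s)` (`s ≤ m`), and it is **clean** if any two rungs are
equal, swapped-equal or disjoint.  `stub_reflectionDefects` (crux NOTES §15.2): the number of structures is at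
most the number of clean ones plus, summed over `s < t ≤ m`, `(s, t) ≠ (0, m)` and the coincidence types
`p_s = p_t`, `q_s = q_t`, `p_s = q_t`, `q_s = p_t`, the sizes of four explicit configuration sets.
Proof: a non-clean structure has rungs `r_s`, `r_t` (`s < t`) sharing a point (`exists_defect`; `(s, t) ≠ (0, m)`
as `r_0`, `r_m` are `c`-edges, which are equal or disjoint, `allowed_of_edges`); for each type
`(a, g) ↦ (P, g.take s, (g.drop s).take (t - s), g.drop t)`, `P := p_s` or `q_s`, is injective
(`injective_split_p`, `injective_split_q`) into the configuration set (`conf_pp`, `conf_qq`, `conf_pq`,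
`conf_qp`), and a union bound finishes (`card_le_clean_add_defects`).  Fixed-point-freeness and `1 ≤ m` are not
used.  Pure finite combinatorics under `import Mathlib`; no definitions (the word action, the reduced words and
all sets are abstracted as variables with hypotheses and instantiated by the `let`s of the statement at the end).
-/

set_option linter.dupNamespace false

namespace Summit.MatrixMultiplication.MatrixMultiplication.Theorems.HyperoctahedralThreshold.ReflDefects

variable {n : ℕ}

-- adapted from Summits/.../SnSubsetDichotomyHyperoctahedralThresholdStubSameColourSupply.lean (same line, p112303)
/-- Walking back along the reversed word undoes the walk (letters are involutions). -/
theorem foldl_walk_reverse (μ : Fin 3 → Equiv.Perm (Fin n)) (hμ : ∀ b, μ b * μ b = 1) :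
    ∀ (w : List (Fin 3)) (x : Fin n),
      w.reverse.foldl (fun v b => μ b v) (w.foldl (fun v b => μ b v) x) = x := by
  intro w
  induction w with
  | nil => intro x; rfl
  | cons c w ih =>
    intro x
    rw [List.foldl_cons, List.reverse_cons, List.foldl_append, ih]
    show μ c (μ c x) = x
    have : (μ c * μ c) x = x := by rw [hμ c]; rfl
    simpa using this

/-- Each colour is an involution: `μ b (μ b x) = x`. -/
theorem mu_mu (μ : Fin 3 → Equiv.Perm (Fin n)) (hμ : ∀ b, μ b * μ b = 1) (b : Fin 3) (x : Fin n) :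
    μ b (μ b x) = x := by
  have : (μ b * μ b) x = x := by rw [hμ b]; rfl
  simpa using this

section Act

variable (μ : Fin 3 → Equiv.Perm (Fin n)) (act : Fin n → List (Fin 3) → Fin n)

/-- The (abstract) word action of the empty word. -/
theorem act_nil (hact : ∀ x w, act x w = w.foldl (fun v b => μ b v) x) (x : Fin n) : act x [] = x := by
  rw [hact]; rfl

/-- The word action of a concatenation. -/
theorem act_append (hact : ∀ x w, act x w = w.foldl (fun v b => μ b v) x) (x : Fin n)
    (u w : List (Fin 3)) : act x (u ++ w) = act (act x u) w := by
  simp only [hact, List.foldl_append]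

/-- Walking back along the reversed word undoes the walk. -/
theorem act_act_reverse (hμ : ∀ b, μ b * μ b = 1)
    (hact : ∀ x w, act x w = w.foldl (fun v b => μ b v) x) (x : Fin n) (w : List (Fin 3)) :
    act (act x w) w.reverse = x := by
  simpa only [hact] using foldl_walk_reverse μ hμ w x

/-- The action of a fixed word is left-cancellative. -/
theorem act_left_cancel (hμ : ∀ b, μ b * μ b = 1)
    (hact : ∀ x w, act x w = w.foldl (fun v b => μ b v) x) {x y : Fin n} (w : List (Fin 3))
    (h : act x w = act y w) : x = y := by
  simpa only [act_act_reverse μ act hμ hact] using congrArg (fun z => act z w.reverse) h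

end Act

-- adapted from Summits/.../SnSubsetDichotomyHyperoctahedralThresholdStubSameColourSupply.lean (same line, p112303)
/-- Membership in the `Finset` of all words of length `m` over a finite alphabet. -/
theorem mem_words {α : Type*} [Fintype α] [DecidableEq α] {m : ℕ} {z : List α} :
    z ∈ (Finset.univ : Finset (List.Vector α m)).image (fun v => v.toList) ↔ z.length = m := by
  constructor
  · intro h
    obtain ⟨v, -, rfl⟩ := Finset.mem_image.1 h
    exact v.toList_length
  · intro h
    exact Finset.mem_image.2 ⟨⟨z, h⟩, Finset.mem_univ _, rfl⟩

/-- Splitting a word of length `m` at positions `s ≤ t ≤ m` into three pieces of lengths `s`, `t - s`,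
`m - t`. -/
theorem split_word {m s t : ℕ} {g : List (Fin 3)} (hlen : g.length = m) (hst : s ≤ t) (htm : t ≤ m) :
    g.take t = g.take s ++ (g.drop s).take (t - s) ∧
    g = g.take s ++ (g.drop s).take (t - s) ++ g.drop t ∧
    (g.take s).length = s ∧ ((g.drop s).take (t - s)).length = t - s ∧ (g.drop t).length = m - t := by
  have h1 : g.take t = g.take s ++ (g.drop s).take (t - s) := by
    rw [← List.take_add, Nat.add_sub_of_le hst]
  refine ⟨h1, ?_, ?_, ?_, ?_⟩
  · rw [← h1, List.take_append_drop]
  · rw [List.length_take]; omega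
  · rw [List.length_take, List.length_drop]; omega
  · rw [List.length_drop, hlen]

/-- Two `c`-edges `(x, μ c x)` and `(y, μ c y)` are equal, swapped-equal or disjoint. -/
theorem allowed_of_edges (μ : Fin 3 → Equiv.Perm (Fin n)) (c : Fin 3) (hμ : ∀ b, μ b * μ b = 1)
    (x y : Fin n) :
    (x = y ∧ μ c x = μ c y) ∨ (x = μ c y ∧ μ c x = y) ∨
      (x ≠ y ∧ x ≠ μ c y ∧ μ c x ≠ y ∧ μ c x ≠ μ c y) := by
  by_cases h1 : x = y
  · exact Or.inl ⟨h1, by rw [h1]⟩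
  · by_cases h2 : x = μ c y
    · exact Or.inr (Or.inl ⟨h2, by rw [h2, mu_mu μ hμ]⟩)
    · refine Or.inr (Or.inr ⟨h1, h2, fun h => h2 ?_, fun h => h1 ((μ c).injective h)⟩)
      rw [← h, mu_mu μ hμ]

/-- Two rungs that are neither equal, swapped-equal nor disjoint share a point. -/
theorem coincidence_of_not_allowed {ps qs pt qt : Fin n}
    (h : ¬ ((ps = pt ∧ qs = qt) ∨ (ps = qt ∧ qs = pt) ∨ (ps ≠ pt ∧ ps ≠ qt ∧ qs ≠ pt ∧ qs ≠ qt))) :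
    ps = pt ∨ qs = qt ∨ ps = qt ∨ qs = pt := by
  by_contra hc
  apply h
  exact Or.inr (Or.inr ⟨fun e => hc (Or.inl e), fun e => hc (Or.inr (Or.inr (Or.inl e))),
    fun e => hc (Or.inr (Or.inr (Or.inr e))), fun e => hc (Or.inr (Or.inl e))⟩)

/-- A non-clean pair `(a, g)` (`|g| = m`, end condition `μ c (a · g) = (μ c a) · g`) has a defect: positions
`s < t ≤ m`, `(s, t) ≠ (0, m)`, at which the rungs `r_s`, `r_t` share a point. -/
theorem exists_defect (μ : Fin 3 → Equiv.Perm (Fin n)) (c : Fin 3) (hμ : ∀ b, μ b * μ b = 1)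
    (act : Fin n → List (Fin 3) → Fin n) (hact : ∀ x w, act x w = w.foldl (fun v b => μ b v) x)
    {m : ℕ} {a : Fin n} {g : List (Fin 3)} (hlen : g.length = m)
    (hend : μ c (act a g) = act (μ c a) g)
    (h : ¬ ∀ s ∈ Finset.range (m + 1), ∀ t ∈ Finset.range (m + 1),
      (act a (g.take s) = act a (g.take t) ∧ act (μ c a) (g.take s) = act (μ c a) (g.take t)) ∨
      (act a (g.take s) = act (μ c a) (g.take t) ∧ act (μ c a) (g.take s) = act a (g.take t)) ∨
      (act a (g.take s) ≠ act a (g.take t) ∧ act a (g.take s) ≠ act (μ c a) (g.take t) ∧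
        act (μ c a) (g.take s) ≠ act a (g.take t) ∧ act (μ c a) (g.take s) ≠ act (μ c a) (g.take t))) :
    ∃ s t, s < t ∧ t ≤ m ∧ ¬ (s = 0 ∧ t = m) ∧
      (act a (g.take s) = act a (g.take t) ∨ act (μ c a) (g.take s) = act (μ c a) (g.take t) ∨
        act a (g.take s) = act (μ c a) (g.take t) ∨ act (μ c a) (g.take s) = act a (g.take t)) := by
  by_contra hcon
  apply h
  intro s hs t ht
  rw [Finset.mem_range] at hs ht
  by_contra hno
  have hc := coincidence_of_not_allowed hno
  rcases lt_trichotomy s t with hlt | rfl | hgt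
  · refine hcon ⟨s, t, hlt, by omega, ?_, hc⟩
    rintro ⟨rfl, rfl⟩
    apply hno
    rw [List.take_zero, List.take_of_length_le (le_of_eq hlen), act_nil μ act hact, act_nil μ act hact,
      ← hend]
    exact allowed_of_edges μ c hμ a (act a g)
  · exact hno (Or.inl ⟨rfl, rfl⟩)
  · refine hcon ⟨t, s, hgt, by omega, ?_, ?_⟩
    · rintro ⟨rfl, rfl⟩
      apply hno
      rw [List.take_zero, List.take_of_length_le (le_of_eq hlen), act_nil μ act hact, act_nil μ act hact,
        ← hend]
      exact allowed_of_edges μ c hμ (act a g) a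
    · rcases hc with e | e | e | e
      exacts [Or.inl e.symm, Or.inr (Or.inl e.symm), Or.inr (Or.inr (Or.inr e.symm)),
        Or.inr (Or.inr (Or.inl e.symm))]

section Conf

variable (μ : Fin 3 → Equiv.Perm (Fin n)) (c : Fin 3) (act : Fin n → List (Fin 3) → Fin n)

/-- Type `p_s = p_t` (`P := p_s = a · α`): the defining identities of `SSp`. -/
theorem conf_pp (hμ : ∀ b, μ b * μ b = 1) (hact : ∀ x w, act x w = w.foldl (fun v b => μ b v) x)
    {a : Fin n} {g w α v β : List (Fin 3)} (hg : g = α ++ v ++ β) (hw : w = α ++ v)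
    (hend : μ c (act a g) = act (μ c a) g) (hcoin : act a α = act a w) :
    act (act a α) v = act a α ∧
      μ c (act (act a α) β) = act (act (act (μ c (act (act a α) α.reverse)) α) v) β := by
  subst hg hw
  simp only [act_append μ act hact] at hend hcoin
  rw [← hcoin] at hend
  rw [act_act_reverse μ act hμ hact]
  exact ⟨hcoin.symm, hend⟩

/-- Type `q_s = q_t` (`P := q_s = (μ c a) · α`): the defining identities of `SSq`. -/
theorem conf_qq (hμ : ∀ b, μ b * μ b = 1) (hact : ∀ x w, act x w = w.foldl (fun v b => μ b v) x)
    {a : Fin n} {g w α v β : List (Fin 3)} (hg : g = α ++ v ++ β) (hw : w = α ++ v)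
    (hend : μ c (act a g) = act (μ c a) g) (hcoin : act (μ c a) α = act (μ c a) w) :
    act (act (μ c a) α) v = act (μ c a) α ∧
      μ c (act (act (act (μ c (act (act (μ c a) α) α.reverse)) α) v) β) = act (act (μ c a) α) β := by
  subst hg hw
  simp only [act_append μ act hact] at hend hcoin
  rw [← hcoin] at hend
  rw [act_act_reverse μ act hμ hact, mu_mu μ hμ]
  exact ⟨hcoin.symm, hend⟩

/-- Type `p_s = q_t` (`P := q_s = (μ c a) · α`, so `p_s = P · v`): the defining identities of `Xpq`. -/
theorem conf_pq (hμ : ∀ b, μ b * μ b = 1) (hact : ∀ x w, act x w = w.foldl (fun v b => μ b v) x)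
    {a : Fin n} {g w α v β : List (Fin 3)} (hg : g = α ++ v ++ β) (hw : w = α ++ v)
    (hend : μ c (act a g) = act (μ c a) g) (hcoin : act a α = act (μ c a) w) :
    μ c (act (act (act (μ c a) α) v) α.reverse) = act (act (μ c a) α) α.reverse ∧
      μ c (act (act (act (act (μ c a) α) v) v) β) = act (act (act (μ c a) α) v) β := by
  subst hg hw
  simp only [act_append μ act hact] at hend hcoin
  rw [← hcoin] at hend ⊢
  rw [act_act_reverse μ act hμ hact, act_act_reverse μ act hμ hact]
  exact ⟨rfl, hend⟩

/-- Type `q_s = p_t` (`P := p_s = a · α`, so `q_s = P · v`): the defining identities of `Xqp`. -/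
theorem conf_qp (hμ : ∀ b, μ b * μ b = 1) (hact : ∀ x w, act x w = w.foldl (fun v b => μ b v) x)
    {a : Fin n} {g w α v β : List (Fin 3)} (hg : g = α ++ v ++ β) (hw : w = α ++ v)
    (hend : μ c (act a g) = act (μ c a) g) (hcoin : act (μ c a) α = act a w) :
    μ c (act (act a α) α.reverse) = act (act (act a α) v) α.reverse ∧
      μ c (act (act (act a α) v) β) = act (act (act (act a α) v) v) β := by
  subst hg hw
  simp only [act_append μ act hact] at hend hcoin
  rw [← hcoin] at hend ⊢
  rw [act_act_reverse μ act hμ hact, act_act_reverse μ act hμ hact]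
  exact ⟨rfl, hend⟩

/-- `(a, g) ↦ (a · g.take s, g.take s, (g.drop s).take (t - s), g.drop t)` is injective (`s ≤ t`). -/
theorem injective_split_p (hμ : ∀ b, μ b * μ b = 1) (hact : ∀ x w, act x w = w.foldl (fun v b => μ b v) x)
    {s t : ℕ} (hst : s ≤ t) :
    Function.Injective (fun p : Fin n × List (Fin 3) =>
      (act p.1 (p.2.take s), p.2.take s, (p.2.drop s).take (t - s), p.2.drop t)) := by
  rintro ⟨a, g⟩ ⟨a', g'⟩ h
  simp only [Prod.mk.injEq] at h
  obtain ⟨hP, hα, hv, hβ⟩ := h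
  have hg : g = g' := by
    rw [← List.take_append_drop s g, ← List.take_append_drop s g',
      ← List.take_append_drop (t - s) (g.drop s), ← List.take_append_drop (t - s) (g'.drop s),
      List.drop_drop, List.drop_drop, Nat.add_sub_of_le hst, hα, hv, hβ]
  subst hg
  rw [act_left_cancel μ act hμ hact _ hP]

/-- `(a, g) ↦ ((μ c a) · g.take s, g.take s, (g.drop s).take (t - s), g.drop t)` is injective (`s ≤ t`). -/
theorem injective_split_q (hμ : ∀ b, μ b * μ b = 1) (hact : ∀ x w, act x w = w.foldl (fun v b => μ b v) x)
    {s t : ℕ} (hst : s ≤ t) :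
    Function.Injective (fun p : Fin n × List (Fin 3) =>
      (act (μ c p.1) (p.2.take s), p.2.take s, (p.2.drop s).take (t - s), p.2.drop t)) := by
  rintro ⟨a, g⟩ ⟨a', g'⟩ h
  simp only [Prod.mk.injEq] at h
  obtain ⟨hP, hα, hv, hβ⟩ := h
  have hg : g = g' := by
    rw [← List.take_append_drop s g, ← List.take_append_drop s g',
      ← List.take_append_drop (t - s) (g.drop s), ← List.take_append_drop (t - s) (g'.drop s),
      List.drop_drop, List.drop_drop, Nat.add_sub_of_le hst, hα, hv, hβ]
  subst hg
  rw [(μ c).injective (act_left_cancel μ act hμ hact _ hP)]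

end Conf

/-- The counting lemma behind `stub_reflectionDefects`, with the word action `act`, the sets of reduced words
`red`, the set of structures `S`, cleanness `clean` and the four configuration sets abstracted. -/
theorem card_le_clean_add_defects (μ : Fin 3 → Equiv.Perm (Fin n)) (c : Fin 3)
    (hμ : ∀ b, μ b * μ b = 1) (m : ℕ) (red : ℕ → Finset (List (Fin 3)))
    (hred : ∀ k w, w.length = k → List.IsChain (· ≠ ·) w → w ∈ red k)
    (act : Fin n → List (Fin 3) → Fin n) (hact : ∀ x w, act x w = w.foldl (fun v b => μ b v) x)
    (S : Finset (Fin n × List (Fin 3)))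
    (hS : ∀ a g, (a, g) ∈ S → (g.length = m ∧ List.IsChain (· ≠ ·) g) ∧ μ c (act a g) = act (μ c a) g)
    (clean : Fin n × List (Fin 3) → Prop) {hdec : DecidablePred clean}
    (hclean : ∀ p, (∀ s ∈ Finset.range (m + 1), ∀ t ∈ Finset.range (m + 1),
      (act p.1 (p.2.take s) = act p.1 (p.2.take t) ∧ act (μ c p.1) (p.2.take s) = act (μ c p.1) (p.2.take t)) ∨
      (act p.1 (p.2.take s) = act (μ c p.1) (p.2.take t) ∧ act (μ c p.1) (p.2.take s) = act p.1 (p.2.take t)) ∨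
      (act p.1 (p.2.take s) ≠ act p.1 (p.2.take t) ∧ act p.1 (p.2.take s) ≠ act (μ c p.1) (p.2.take t) ∧
        act (μ c p.1) (p.2.take s) ≠ act p.1 (p.2.take t) ∧
        act (μ c p.1) (p.2.take s) ≠ act (μ c p.1) (p.2.take t))) → clean p)
    (SSp SSq Xpq Xqp : ℕ → ℕ → Finset (Fin n × List (Fin 3) × List (Fin 3) × List (Fin 3)))
    (hSSp : ∀ s t P α v β, α ∈ red s → v ∈ red (t - s) → β ∈ red (m - t) →
      act P v = P → μ c (act P β) = act (act (act (μ c (act P α.reverse)) α) v) β → (P, α, v, β) ∈ SSp s t)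
    (hSSq : ∀ s t P α v β, α ∈ red s → v ∈ red (t - s) → β ∈ red (m - t) →
      act P v = P → μ c (act (act (act (μ c (act P α.reverse)) α) v) β) = act P β → (P, α, v, β) ∈ SSq s t)
    (hXpq : ∀ s t P α v β, α ∈ red s → v ∈ red (t - s) → β ∈ red (m - t) →
      μ c (act (act P v) α.reverse) = act P α.reverse →
      μ c (act (act (act P v) v) β) = act (act P v) β → (P, α, v, β) ∈ Xpq s t)
    (hXqp : ∀ s t P α v β, α ∈ red s → v ∈ red (t - s) → β ∈ red (m - t) →
      μ c (act P α.reverse) = act (act P v) α.reverse →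
      μ c (act (act P v) β) = act (act (act P v) v) β → (P, α, v, β) ∈ Xqp s t) :
    S.card ≤ (S.filter clean).card +
      ∑ s ∈ Finset.range (m + 1), ∑ t ∈ Finset.range (m + 1),
        (if s < t ∧ ¬ (s = 0 ∧ t = m) then
          ((SSp s t).card + (SSq s t).card + (Xpq s t).card + (Xqp s t).card) else 0) := by
  /- 1. The four injections at fixed positions `s ≤ t ≤ m`. -/
  have hpp : ∀ s t, s ≤ t → t ≤ m →
      (S.filter (fun p => act p.1 (p.2.take s) = act p.1 (p.2.take t))).card ≤ (SSp s t).card := by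
    intro s t hst htm
    refine Finset.card_le_card_of_injOn
      (fun p => (act p.1 (p.2.take s), p.2.take s, (p.2.drop s).take (t - s), p.2.drop t)) ?_
      (injective_split_p μ act hμ hact hst).injOn
    rintro ⟨a, g⟩ hp
    obtain ⟨hpS, hco⟩ := by simpa only [Finset.coe_filter, Set.mem_setOf_eq] using hp
    obtain ⟨⟨hlen, hch⟩, hend⟩ := hS a g hpS
    obtain ⟨htake, hg, hlα, hlv, hlβ⟩ := split_word hlen hst htm
    obtain ⟨h1, h2⟩ := conf_pp μ c act hμ hact hg htake hend hco
    exact Finset.mem_coe.2 (hSSp s t _ _ _ _ (hred _ _ hlα (hch.take s))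
      (hred _ _ hlv ((hch.drop s).take (t - s))) (hred _ _ hlβ (hch.drop t)) h1 h2)
  have hqq : ∀ s t, s ≤ t → t ≤ m →
      (S.filter (fun p => act (μ c p.1) (p.2.take s) = act (μ c p.1) (p.2.take t))).card ≤ (SSq s t).card := by
    intro s t hst htm
    refine Finset.card_le_card_of_injOn
      (fun p => (act (μ c p.1) (p.2.take s), p.2.take s, (p.2.drop s).take (t - s), p.2.drop t)) ?_
      (injective_split_q μ c act hμ hact hst).injOn
    rintro ⟨a, g⟩ hp
    obtain ⟨hpS, hco⟩ := by simpa only [Finset.coe_filter, Set.mem_setOf_eq] using hp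
    obtain ⟨⟨hlen, hch⟩, hend⟩ := hS a g hpS
    obtain ⟨htake, hg, hlα, hlv, hlβ⟩ := split_word hlen hst htm
    obtain ⟨h1, h2⟩ := conf_qq μ c act hμ hact hg htake hend hco
    exact Finset.mem_coe.2 (hSSq s t _ _ _ _ (hred _ _ hlα (hch.take s))
      (hred _ _ hlv ((hch.drop s).take (t - s))) (hred _ _ hlβ (hch.drop t)) h1 h2)
  have hpq : ∀ s t, s ≤ t → t ≤ m →
      (S.filter (fun p => act p.1 (p.2.take s) = act (μ c p.1) (p.2.take t))).card ≤ (Xpq s t).card := by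
    intro s t hst htm
    refine Finset.card_le_card_of_injOn
      (fun p => (act (μ c p.1) (p.2.take s), p.2.take s, (p.2.drop s).take (t - s), p.2.drop t)) ?_
      (injective_split_q μ c act hμ hact hst).injOn
    rintro ⟨a, g⟩ hp
    obtain ⟨hpS, hco⟩ := by simpa only [Finset.coe_filter, Set.mem_setOf_eq] using hp
    obtain ⟨⟨hlen, hch⟩, hend⟩ := hS a g hpS
    obtain ⟨htake, hg, hlα, hlv, hlβ⟩ := split_word hlen hst htm
    obtain ⟨h1, h2⟩ := conf_pq μ c act hμ hact hg htake hend hco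
    exact Finset.mem_coe.2 (hXpq s t _ _ _ _ (hred _ _ hlα (hch.take s))
      (hred _ _ hlv ((hch.drop s).take (t - s))) (hred _ _ hlβ (hch.drop t)) h1 h2)
  have hqp : ∀ s t, s ≤ t → t ≤ m →
      (S.filter (fun p => act (μ c p.1) (p.2.take s) = act p.1 (p.2.take t))).card ≤ (Xqp s t).card := by
    intro s t hst htm
    refine Finset.card_le_card_of_injOn
      (fun p => (act p.1 (p.2.take s), p.2.take s, (p.2.drop s).take (t - s), p.2.drop t)) ?_
      (injective_split_p μ act hμ hact hst).injOn
    rintro ⟨a, g⟩ hp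
    obtain ⟨hpS, hco⟩ := by simpa only [Finset.coe_filter, Set.mem_setOf_eq] using hp
    obtain ⟨⟨hlen, hch⟩, hend⟩ := hS a g hpS
    obtain ⟨htake, hg, hlα, hlv, hlβ⟩ := split_word hlen hst htm
    obtain ⟨h1, h2⟩ := conf_qp μ c act hμ hact hg htake hend hco
    exact Finset.mem_coe.2 (hXqp s t _ _ _ _ (hred _ _ hlα (hch.take s))
      (hred _ _ hlv ((hch.drop s).take (t - s))) (hred _ _ hlβ (hch.drop t)) h1 h2)
  /- 2. The index set of defect positions and the defect sets. -/
  obtain ⟨I, hI⟩ : ∃ I : Finset (ℕ × ℕ), I = ((Finset.range (m + 1)) ×ˢ (Finset.range (m + 1))).filter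
      (fun st => st.1 < st.2 ∧ ¬ (st.1 = 0 ∧ st.2 = m)) := ⟨_, rfl⟩
  obtain ⟨D, hD⟩ : ∃ D : ℕ × ℕ → Finset (Fin n × List (Fin 3)), ∀ st, D st =
      S.filter (fun p => act p.1 (p.2.take st.1) = act p.1 (p.2.take st.2)) ∪
        S.filter (fun p => act (μ c p.1) (p.2.take st.1) = act (μ c p.1) (p.2.take st.2)) ∪
        S.filter (fun p => act p.1 (p.2.take st.1) = act (μ c p.1) (p.2.take st.2)) ∪
        S.filter (fun p => act (μ c p.1) (p.2.take st.1) = act p.1 (p.2.take st.2)) := ⟨_, fun st => rfl⟩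
  /- 3. Every non-clean structure lies in some defect set. -/
  have hcover : S.filter (fun p => ¬ clean p) ⊆ I.biUnion D := by
    rintro ⟨a, g⟩ hp
    rw [Finset.mem_filter] at hp
    obtain ⟨hpS, hnc⟩ := hp
    obtain ⟨⟨hlen, -⟩, hend⟩ := hS a g hpS
    obtain ⟨s, t, hst, htm, hne, hco⟩ := exists_defect μ c hμ act hact hlen hend (mt (hclean (a, g)) hnc)
    rw [Finset.mem_biUnion]
    refine ⟨(s, t), ?_, ?_⟩
    · simp only [hI, Finset.mem_filter, Finset.mem_product, Finset.mem_range]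
      exact ⟨⟨by omega, by omega⟩, hst, hne⟩
    · simp only [hD, Finset.mem_union, Finset.mem_filter]
      rcases hco with h | h | h | h
      · exact Or.inl (Or.inl (Or.inl ⟨hpS, h⟩))
      · exact Or.inl (Or.inl (Or.inr ⟨hpS, h⟩))
      · exact Or.inl (Or.inr ⟨hpS, h⟩)
      · exact Or.inr ⟨hpS, h⟩
  /- 4. Each defect set is bounded by the four configuration counts. -/
  have hpiece : ∀ st ∈ I, (D st).card ≤
      (SSp st.1 st.2).card + (SSq st.1 st.2).card + (Xpq st.1 st.2).card + (Xqp st.1 st.2).card := by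
    rintro ⟨s, t⟩ hst
    simp only [hI, Finset.mem_filter, Finset.mem_product, Finset.mem_range] at hst
    obtain ⟨⟨-, ht⟩, hlt, -⟩ := hst
    have htm : t ≤ m := by omega
    rw [hD]
    exact (Finset.card_union_le _ _).trans (Nat.add_le_add ((Finset.card_union_le _ _).trans
      (Nat.add_le_add ((Finset.card_union_le _ _).trans (Nat.add_le_add (hpp s t hlt.le htm)
        (hqq s t hlt.le htm))) (hpq s t hlt.le htm))) (hqp s t hlt.le htm))
  /- 5. Assembly. -/
  rw [← Finset.card_filter_add_card_filter_not (s := S) clean]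
  apply Nat.add_le_add_left
  calc (S.filter (fun p => ¬ clean p)).card
      ≤ (I.biUnion D).card := Finset.card_le_card hcover
    _ ≤ ∑ st ∈ I, (D st).card := Finset.card_biUnion_le
    _ ≤ ∑ st ∈ I, ((SSp st.1 st.2).card + (SSq st.1 st.2).card + (Xpq st.1 st.2).card +
          (Xqp st.1 st.2).card) := Finset.sum_le_sum hpiece
    _ = ∑ s ∈ Finset.range (m + 1), ∑ t ∈ Finset.range (m + 1),
          (if s < t ∧ ¬ (s = 0 ∧ t = m) then
            ((SSp s t).card + (SSq s t).card + (Xpq s t).card + (Xqp s t).card) else 0) := by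
      rw [hI, Finset.sum_filter, Finset.sum_product]

/-- **Reflection defects** (crux NOTES §15.2): the same-colour structures of colour `c` and length `m` number at
most the clean ones plus, over the defect positions `s < t`, `(s, t) ≠ (0, m)`, and the four coincidence types,
the sizes of the configuration sets `SSp`, `SSq`, `Xpq`, `Xqp`. -/
theorem stub_reflectionDefects : ∀ (n m : ℕ) (μ : Fin 3 → Equiv.Perm (Fin n)) (c : Fin 3), (∀ b, μ b * μ b = 1) → (∀ b v, μ b v ≠ v) → 1 ≤ m → let red : ℕ → Finset (List (Fin 3)) := fun k => ((Finset.univ : Finset (List.Vector (Fin 3) k)).image (fun v => v.toList)).filter (fun w => List.IsChain (· ≠ ·) w); let act : Fin n → List (Fin 3) → Fin n := fun x w => w.foldl (fun v b => μ b v) x; let S : Finset (Fin n × List (Fin 3)) := ((Finset.univ : Finset (Fin n)) ×ˢ (red m).filter (fun g => g.head? ≠ some c ∧ g.getLast? ≠ some c)).filter (fun p => μ c (act p.1 p.2) = act (μ c p.1) p.2); let clean : Fin n × List (Fin 3) → Prop := fun p => ∀ s ∈ Finset.range (m + 1), ∀ t ∈ Finset.range (m + 1), (act p.1 (p.2.take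 s) = act p.1 (p.2.take t) ∧ act (μ c p.1) (p.2.take s) = act (μ c p.1) (p.2.take t)) ∨ (act p.1 (p.2.take s) = act (μ c p.1) (p.2.take t) ∧ act (μ c p.1) (p.2.take s) = act p.1 (p.2.take t)) ∨ (act p.1 (p.2.take s) ≠ act p.1 (p.2.take t) ∧ act p.1 (p.2.take s) ≠ act (μ c p.1) (p.2.take t) ∧ act (μ c p.1) (p.2.take s) ≠ act p.1 (p.2.take t) ∧ act (μ c p.1) (p.2.take s) ≠ act (μ c p.1) (p.2.take t)); let SSp : ℕ → ℕ → Finset (Fin n × List (Fin 3) × List (Fin 3) × List (Fin 3)) := fun s t => ((Finset.univ : Finset (Fin n)) ×ˢ red s ×ˢ red (t - s) ×ˢ red (m - t)).filter (fun q => act q.1 q.2.2.1 = q.1 ∧ μ c (act q.1 q.2.2.2) = act (act (act (μ c (act q.1 q.2.1.reverse)) q.2.1) q.2.2.1) q.2.2.2); let SSq : ℕ → ℕ → Finset (Fin n × List (Fin 3) × List (Fin 3) × List (Fin 3)) := fun s t => ((Finset.univ : Finset (Fin n)) ×ˢ red s ×ˢ red (t - s) ×ˢ red (m - t)).filter (fun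 q => act q.1 q.2.2.1 = q.1 ∧ μ c (act (act (act (μ c (act q.1 q.2.1.reverse)) q.2.1) q.2.2.1) q.2.2.2) = act q.1 q.2.2.2); let Xpq : ℕ → ℕ → Finset (Fin n × List (Fin 3) × List (Fin 3) × List (Fin 3)) := fun s t => ((Finset.univ : Finset (Fin n)) ×ˢ red s ×ˢ red (t - s) ×ˢ red (m - t)).filter (fun q => μ c (act (act q.1 q.2.2.1) q.2.1.reverse) = act q.1 q.2.1.reverse ∧ μ c (act (act (act q.1 q.2.2.1) q.2.2.1) q.2.2.2) = act (act q.1 q.2.2.1) q.2.2.2); let Xqp : ℕ → ℕ → Finset (Fin n × List (Fin 3) × List (Fin 3) × List (Fin 3)) := fun s t => ((Finset.univ : Finset (Fin n)) ×ˢ red s ×ˢ red (t - s) ×ˢ red (m - t)).filter (fun q => μ c (act q.1 q.2.1.reverse) = act (act q.1 q.2.2.1) q.2.1.reverse ∧ μ c (act (act q.1 q.2.2.1) q.2.2.2) = act (act (act q.1 q.2.2.1) q.2.2.1) q.2.2.2); S.card ≤ (S.filter clean).card + ∑ s ∈ Finset.range (m + 1), ∑ t ∈ Finset.range (m + 1),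 (if s < t ∧ ¬ (s = 0 ∧ t = m) then ((SSp s t).card + (SSq s t).card + (Xpq s t).card + (Xqp s t).card) else 0) := by
  intro n m μ c hμ _ _ red act S clean SSp SSq Xpq Xqp
  refine card_le_clean_add_defects μ c hμ m red ?_ act (fun x w => rfl) S ?_ clean (fun p hp => hp)
    SSp SSq Xpq Xqp ?_ ?_ ?_ ?_
  · intro k w hl hc
    exact Finset.mem_filter.2 ⟨mem_words.2 hl, hc⟩
  · intro a g h
    have h1 := Finset.mem_filter.1 h
    have h2 := Finset.mem_filter.1 (Finset.mem_product.1 h1.1).2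
    exact ⟨⟨mem_words.1 (Finset.mem_filter.1 h2.1).1, (Finset.mem_filter.1 h2.1).2⟩, h1.2⟩
  all_goals
    intro s t P α v β h1 h2 h3 h4 h5
    exact Finset.mem_filter.2 ⟨Finset.mem_product.2 ⟨Finset.mem_univ _, Finset.mem_product.2 ⟨h1,
      Finset.mem_product.2 ⟨h2, h3⟩⟩⟩, h4, h5⟩

end Summit.MatrixMultiplication.MatrixMultiplication.Theorems.HyperoctahedralThreshold.ReflDefects
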